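import Summits.ResolutionOfSingularities.ResolutionOfSingularities.Theorems.MarkedTransferCampaignW46LargeCharRegime
import Summits.ResolutionOfSingularities.ResolutionOfSingularities.Theorems.MarkedTransferCampaignW46LargeCharStatement
import HarnessLib

/-!
# [OURS · L1 W4.6, rung (iv) «large characteristic»] PROOFS BY NAME of the rung-(iv) statements
# `Theorems/MarkedTransferCampaignW46LargeCharStatement.lean` (res-L1-type-o1, p473772) from
# `Theorems/MarkedTransferCampaignW46LargeCharRegime.lean` (res-L1-s46-pv-7, p471737)
# (cell res-hironaka, LADDER-RESOLUTION rung L, D-0089; slot W4.6, seat res-L1-s46-pv-7; host route MarkedTransfer,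
# `--supports stmt-ResolutionOfSingularities-16155 --as helper`)

HONEST FRAMING. Nothing here is a statement of H. Hironaka's manuscript (2017-03-23, [Hironaka2017]) and nothing here
asserts that any statement of it holds. Each theorem closes an OURS campaign predicate BY NAME with a theorem already in
the tree; no new mathematics. AI review is weaker than expert review. No `sorry`; axioms standard.

* `campaignW46TameStall_holds : CampaignW46TameStall p K n` — every regime: a tame witness (résumé terminal at stage
  `0`, a step, a résumé of the transform, a closed point over the centre off `D′`) refutes `DecreaseAlongSteps`
  (`CampaignW46.not_decreaseAlongSteps_of_tameWitness`). Design point (M) `m := t`; a READING, not a verdict.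
* `campaignW46LargeCharTameStall_holds : CampaignW46LargeCharTameStall p K n` — item (B) of the split: the same in the
  large-characteristic regimes `Regime.charGT n C`, every explicit `C`.
* `CampaignW46.not_decreaseAlongSteps_of_tameWitnessNabla` — the ∇-centred witness shape `TameWitnessNabla` refutes
  `DecreaseAlongSteps` (`not_decreaseAlongSteps_of_tameWitness_nabla`).
* `campaignW46LargeCharExistence_holds : CampaignW46LargeCharExistence n d l` — item (A): existence of resolutions for
  `p > p₀(n, d, l)` = the tree's PROVED `BierstoneGrigorievMilmanWlodarczyk2011_holds`
  (`CampaignW46.largeChar_boundedComplexity_hasResolution`); threshold NOT explicit.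
* `campaignW46LargeCharHypersurfaceExistence_holds : CampaignW46LargeCharHypersurfaceExistence n d` — hypersurface case.
* `…_all` forms with every parameter universally quantified (the shapes an item would register).
-/

noncomputable section

set_option linter.dupNamespace false -- mandated namespace of this single-conjunct summit

open CategoryTheory AlgebraicGeometry TopologicalSpace

namespace Summit.ResolutionOfSingularities.ResolutionOfSingularities.Theorems

universe u

namespace CampaignW46

variable {n : ℕ} {p : ℕ} [Fact p.Prime] {K : Type u} [Field K] [CharP K p]

/-- [OURS · L1 W4.6 (iv); NOT a statement of the manuscript] A tame witness refutes the one-step rung shape (the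
existential `TameWitness` unpacked into `not_decreaseAlongSteps_of_tameWitness`). [folklore] -/
theorem not_decreaseAlongSteps_of_tameWitness' {N : Notions.{u} n} {Rd : Reading p K N} {Rg : Regime p K}
    (h : TameWitness N Rd Rg) : ¬ DecreaseAlongSteps N Rd Rg := by
  obtain ⟨A, E, R, hRg, hRd, hm, A', s, R', hRd', ξ', hcl, hD, hD'⟩ := h
  exact not_decreaseAlongSteps_of_tameWitness R hRg hRd hm s R' hRd' hcl hD hD'

/-- [OURS · L1 W4.6 (iv); NOT a statement of the manuscript] A ∇-centred tame witness (`TameWitnessNabla`: centre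
`⊇ ∇(E)`, a closed point over the centre; no `D′` datum) refutes the one-step rung shape
(`not_decreaseAlongSteps_of_tameWitness_nabla`). [folklore] -/
theorem not_decreaseAlongSteps_of_tameWitnessNabla {N : Notions.{u} n} {Rd : Reading p K N} {Rg : Regime p K}
    (h : TameWitnessNabla N Rd Rg) : ¬ DecreaseAlongSteps N Rd Rg := by
  obtain ⟨A, E, R, hRg, hRd, hm, A', s, hDn, R', hRd', ξ', hcl, hD⟩ := h
  exact not_decreaseAlongSteps_of_tameWitness_nabla R hRg hRd hm s hDn R' hRd' hcl hD

/-- Pure logic: a tame witness in a smaller regime is a tame witness in any larger one. [folklore] -/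
theorem TameWitness.mono {N : Notions.{u} n} {Rd : Reading p K N} {Rg₁ Rg₂ : Regime p K}
    (hle : ∀ A E, Rg₁ A E → Rg₂ A E) (h : TameWitness N Rd Rg₁) : TameWitness N Rd Rg₂ := by
  obtain ⟨A, E, R, hRg, hRd, hm, A', s, R', hRd', ξ', hcl, hD, hD'⟩ := h
  exact ⟨A, E, R, hle A E hRg, hRd, hm, A', s, R', hRd', ξ', hcl, hD, hD'⟩

/-- Pure logic: the same for ∇-centred tame witnesses. [folklore] -/
theorem TameWitnessNabla.mono {N : Notions.{u} n} {Rd : Reading p K N} {Rg₁ Rg₂ : Regime p K}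
    (hle : ∀ A E, Rg₁ A E → Rg₂ A E) (h : TameWitnessNabla N Rd Rg₁) : TameWitnessNabla N Rd Rg₂ := by
  obtain ⟨A, E, R, hRg, hRd, hm, A', s, hDn, R', hRd', ξ', hcl, hD⟩ := h
  exact ⟨A, E, R, hle A E hRg, hRd, hm, A', s, hDn, R', hRd', ξ', hcl, hD⟩

/-- Pure logic: a tame witness in the regime `p > C′ n b` is one in every regime `p > C n b` with `C ≤ C′`.
[folklore] -/
theorem TameWitness.charGT_mono {N : Notions.{u} n} {Rd : Reading p K N} {C C' : ℕ → ℕ → ℕ}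
    (hle : ∀ b, C n b ≤ C' n b) (h : TameWitness N Rd (Regime.charGT n C')) :
    TameWitness N Rd (Regime.charGT n C) :=
  h.mono fun A E hE => Regime.charGT_of_le hle A E hE

end CampaignW46

/-! ## The campaign predicates, closed by name -/

/-- [OURS · L1 W4.6 (iv); NOT a statement of the manuscript] **`CampaignW46TameStall` holds** for every `p`, `K`, `n`:
in every regime a tame witness refutes `DecreaseAlongSteps` (res-L1-s46-pv-7's
`CampaignW46.not_decreaseAlongSteps_of_tameWitness`, p471737). READING under design point (M), not a verdict. [folklore] -/
theorem campaignW46TameStall_holds (p : ℕ) [Fact p.Prime] (K : Type u) [Field K] [CharP K p] (n : ℕ) :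
    CampaignW46TameStall p K n :=
  fun _ _ _ hw => CampaignW46.not_decreaseAlongSteps_of_tameWitness' hw

/-- [OURS · L1 W4.6 (iv); NOT a statement of the manuscript] **`CampaignW46LargeCharTameStall` holds** — item (B) of
the rung-(iv) split (STATUS 2026-08-26T22:41:48Z): for every explicit threshold `C`, a tame witness in the regime
`p > C n b` refutes the one-step Eq. (127)-shape there. [folklore] -/
theorem campaignW46LargeCharTameStall_holds (p : ℕ) [Fact p.Prime] (K : Type u) [Field K] [CharP K p] (n : ℕ) :
    CampaignW46LargeCharTameStall p K n :=
  fun N Rd C hw => campaignW46TameStall_holds p K n N Rd (CampaignW46.Regime.charGT n C) hw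

/-- [OURS · L1 W4.6 (iv); NOT a statement of the manuscript] **`CampaignW46LargeCharExistence` holds** — item (A) of the
rung-(iv) split: for every `(n, d, l)` there is `p₀` beyond which every integral `Y = V(S) ⊆ 𝔸ⁿ_k` (`|S| ≤ l`, degrees
`≤ d`, `k` perfect of characteristic `p > p₀`) has a resolution — the tree's PROVED
`Literature.AlgebraicGeometry.Resolution.BierstoneGrigorievMilmanWlodarczyk2011_holds` through
`CampaignW46.largeChar_boundedComplexity_hasResolution` (p471737). Threshold NOT explicit. [folklore] -/
theorem campaignW46LargeCharExistence_holds (n d l : ℕ) : CampaignW46LargeCharExistence n d l :=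
  CampaignW46.largeChar_boundedComplexity_hasResolution n d l

/-- [OURS · L1 W4.6 (iv); NOT a statement of the manuscript] **`CampaignW46LargeCharHypersurfaceExistence` holds** —
the hypersurface case `l = 1` (`CampaignW46.largeChar_hypersurface_hasResolution`, p471737). [folklore] -/
theorem campaignW46LargeCharHypersurfaceExistence_holds (n d : ℕ) : CampaignW46LargeCharHypersurfaceExistence n d :=
  CampaignW46.largeChar_hypersurface_hasResolution n d

/-! ## Fully quantified forms (the shapes a rank-9 item would register) -/

/-- [OURS · L1 W4.6 (iv)] `∀ n d l, CampaignW46LargeCharExistence n d l`. [folklore] -/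
theorem campaignW46LargeCharExistence_all : ∀ n d l : ℕ, CampaignW46LargeCharExistence n d l :=
  campaignW46LargeCharExistence_holds

/-- [OURS · L1 W4.6 (iv)] `∀ n d, CampaignW46LargeCharHypersurfaceExistence n d`. [folklore] -/
theorem campaignW46LargeCharHypersurfaceExistence_all : ∀ n d : ℕ, CampaignW46LargeCharHypersurfaceExistence n d :=
  campaignW46LargeCharHypersurfaceExistence_holds

/-- [OURS · L1 W4.6 (iv)] `∀ p K n, CampaignW46LargeCharTameStall p K n`. [folklore] -/
theorem campaignW46LargeCharTameStall_all :
    ∀ (p : ℕ) [Fact p.Prime] (K : Type u) [Field K] [CharP K p] (n : ℕ), CampaignW46LargeCharTameStall p K n :=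
  fun p _ K _ _ n => campaignW46LargeCharTameStall_holds p K n

/-- [OURS · L1 W4.6 (iv)] `∀ p K n, CampaignW46TameStall p K n`. [folklore] -/
theorem campaignW46TameStall_all :
    ∀ (p : ℕ) [Fact p.Prime] (K : Type u) [Field K] [CharP K p] (n : ℕ), CampaignW46TameStall p K n :=
  fun p _ K _ _ n => campaignW46TameStall_holds p K n

end Summit.ResolutionOfSingularities.ResolutionOfSingularities.Theorems

end
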